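import Literature.NumberTheory.EllipticCurves.EtaQuotientQExpansionProofs
import Literature.NumberTheory.EllipticCurves.WeightOneEtaQuotientsProofs
import Literature.NumberTheory.EllipticCurves.DeligneSerreProp27HigherWeightProofs
import Literature.NumberTheory.EllipticCurves.DeligneSerreProp27RealLatticeProofs
import Literature.NumberTheory.EllipticCurves.DeligneSerreProp27WeightReductionProofs
import Literature.NumberTheory.EllipticCurves.NewformsSpanGamma1Proofs
import Literature.NumberTheory.EllipticCurves.EichlerShimuraPeriodsGamma1RealSpanProofs
import HarnessLib

/-!
# Deligne–Serre 1974, Prop. 2.7 in weight one from weight two: descent by the `η`-quotients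
# `θ²`-type of level `8`, and `T₂` through `U₂` at level `8N`

`DeligneSerreProp27HigherWeightProofs` proved the named fact `DeligneSerre1974.prop27_eigenvalues`
(`DeligneSerreRankinProofs`: Deligne–Serre 1974, Prop. 2.7 (2.7.3) — the eigenvalues `a_p`, `p ∤ N`,
of a non-zero `T_p`-eigenform of type `(k, ε)` on `Γ₁(N)` are algebraic integers of one number
field) in every weight `k ≠ 1`, and reduced weight one to Deligne–Serre's (2.7.2)
(`DeligneSerre1974_span_integralLattice1`) in weights `5` and `7` (division by `E₄`, `E₆`).  The
tree has meanwhile (`DeligneSerreSpanHeckeDualityProofs`, `DeligneSerreProp27RealLatticeProofs`)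
reduced (2.7.2) in a weight `k ≥ 2` to a full Hecke-stable real lattice in `S_k(Γ₁(N))^∨`
(`HeckeStableRealLattice N k`, Shimura's (3.5.20) = the rank statement of Eichler–Shimura).  In odd
weight `≥ 5` that is vector-valued Eichler–Shimura theory; in weight `2` it is the exact `Γ₁(N)`
analogue of the DISCHARGED `periodHomology_eq_span_basis` (`Γ₀(N)`: Manin's bound, the genus
formula and the maximum principle).  This file brings weight one down to **weight two**:

* **Descent `k + 1 ↦ k` at levels `8 ∣ N`**
  (`DeligneSerre1974_span_integralLattice1.of_weight_succ_of_eight_dvd`): with the two weight-one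
  `η`-quotients `g₁ = η(2τ)¹⁰/(η(τ)η(4τ))⁴`, `g₂ = g₁(2τ)` of `WeightOneEtaQuotientsProofs`
  (`thetaSqForm`, `thetaSqTwoForm ∈ M₁(Γ₁(N))`; classically `θ(τ)²`, `θ(2τ)²`) in place of `E₄`,
  `E₆` the argument of `DeligneSerre1974_span_integralLattice1.of_weight_add`
  (`DeligneSerreProp27WeightReductionProofs`) goes through verbatim: `f ↦ (f g₁, f g₂)` identifies
  `S_k(Γ₁(N))` with the pairs `(h₁, h₂)`, `h₁ g₂ = h₂ g₁` in `S_{k+1}(Γ₁(N))²` — the division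
  `exists_of_thetaSqTwo_mul_eq` uses that `g₁, g₂` have no zero on `ℍ` (`η ≠ 0`) and no common zero
  at any cusp (`exists_eventually_le_norm_thetaSqForm_slash`); this is a linear system with
  integer coefficients on lattice coordinates (the `q`-expansions of `g₁`, `g₂` are integral:
  `exists_int_map_eq_qExpansion_etaQuotient`), so its solutions are spanned by rational ones
  (`exists_algebraMap_coords`), and a rational solution `h₁ = g₁ F` has `D F ∈ L_k`, because
  `⟨d⟩(D F) g₁ = ±⟨d⟩(D h₁)` (`g₁ ∣[1] γ = χ₋₄(d) g₁` on `Γ₀(N)`,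
  `diamondOp_mulModularForm_of_slash_chi4`) and `g₁` is a unit of `ℤ⟦q⟧`.  Hence (2.7.2) in a
  weight `K₀` at a level `8 ∣ N` gives it in every weight `≤ K₀` (`…of_le_of_eight_dvd`).
* **Weight one at level `N` from weight one at level `8N`**
  (`prop27_weightOne_of_span_integralLattice1_eight_mul`): the inclusion
  `ι = [α₁] : S₁(Γ₁(N)) → S₁(Γ₁(8N))` preserves `q`-expansions and commutes with `T_p` for odd
  `p ∤ N` (`heckeT_degeneracyMap1_of_not_dvd`), so those `a_p` are eigenvalues of the integral
  operators `T_p` on `S₁(Γ₁(8N))`; for `p = 2 ∤ N` the level-`8N` operator is `U₂`, and on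
  `W = ⟨ι f, ι₂ f⟩` (`ι₂ = [α₂]`, `U₂ ι f = ι T₂ f - ι₂ ⟨2⟩ f`, `U₂ ι₂ f = ι f`:
  `heckeT_degeneracyMap1_of_dvd_of_not_dvd`, `heckeT_degeneracyMap1_mul`, Diamond–Shurman
  Prop. 5.6.2) `U₂` satisfies `X² - a₂X + ε(2)`, whose two roots `α, β` are `U₂`-eigenvalues with
  the explicit eigenvectors `ι f - β ι₂ f`, `ι f - α ι₂ f` (non-zero: `f(τ)` and `f(2τ)` are
  independent), hence algebraic integers of a common finitely generated ring, and `a₂ = α + β`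
  (`weightOne_heckeEigenvalue_two_mem`).
* **Assembly**: `prop27_eigenvalues` follows from (2.7.2) in weight `1` at the levels `8N`
  (`prop27_eigenvalues_of_span_integralLattice1_one_eight_mul`), hence from (2.7.2) in weight `2`
  at the levels `8N` (`…_two_eight_mul`), hence from a full Hecke-stable real lattice in
  `S₂(Γ₁(8N))^∨` for every `N` (`prop27_eigenvalues_of_forall_heckeStableRealLattice_two`), i.e.
  from the rank statement of weight-two Eichler–Shimura for `Γ₁(8N)`
  (`prop27_eigenvalues_of_forall_periodLatticeK1_zero_eq_span`, the period lattice
  `periodLatticeK1 0` of `EichlerShimuraPeriodsGamma1`).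
* **One weight suffices** (§6): by the descent, (2.7.2) resp. a full Hecke-stable lattice in any
  ONE weight `K₀ ≥ 2` at the levels `8 ∣ M` gives `prop27_eigenvalues`
  (`…_of_span_integralLattice1_of_eight_dvd`, `…_of_forall_heckeStableRealLattice_of_two_le`);
  in a weight `≥ 7` the spanning half is the tree's `periodLatticeK1_span_real_eq_top`
  (`EichlerShimuraPeriodsGamma1RealSpanProofs`), so only the RANK half of Eichler–Shimura in one
  weight `≥ 7` remains (`prop27_eigenvalues_of_forall_periodLatticeK1_eq_span_of_five_le`).

Everything here is proved; no named facts are introduced.  (Dividing by weight-one theta/eta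
quotients to reach weight one is the standard device of the computational literature on
weight-one forms, e.g. Buzzard–Lauder; here it transports Deligne–Serre's rational structure.)

## References

* P. Deligne, J.-P. Serre, *Formes modulaires de poids 1*, Ann. Sci. ÉNS (4) 7 (1974), Prop. 2.7,
  Rem. 2.8 (p. 512).
* F. Diamond, J. Shurman, *A first course in modular forms*, GTM 228 (2005), Prop. 5.6.2, §5.7
  (degeneracy maps `[α_d]`, `U_p` on old forms).
* K. Buzzard, A. Lauder, *A computation of modular forms of weight one and small level*, Ann.
  Math. Québec 41 (2017), §2 (weight one by division by theta series / Eisenstein series).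
* G. Köhler, *Eta products and theta series identities*, Springer 2011, §1.2
  (`θ² = η(2τ)¹⁰/(η(τ)η(4τ))⁴`).
-/

noncomputable section

open scoped MatrixGroups ModularForm Topology Manifold
open CongruenceSubgroup UpperHalfPlane ModularForm Filter

namespace Literature.NumberTheory.EllipticCurves.ModularForms

/-! ### 1. Cusp forms on `Γ₁(N)` times modular forms on `Γ₁(N)` -/

section MulForm

variable {N : ℕ} [NeZero N] {k w : ℤ}

/-- The `q`-expansion of `f G` (`f ∈ S_k(Γ₁(N))`, `G ∈ M_w(Γ₁(N))`) is the product of the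
`q`-expansions (Mathlib `ModularForm.qExpansion_mul_coe`). [folklore] -/
theorem qExpansion_mulModularForm_gamma1 (G : ModularForm (Gamma1 N) w)
    (f : CuspForm (Gamma1 N) k) :
    qExpansion 1 (⇑(f.mulModularForm G)) = qExpansion 1 ⇑f * qExpansion 1 ⇑G := by
  rw [CuspForm.coe_mulModularForm]
  exact ModularForm.qExpansion_mul_coe one_pos (HeckeTGamma1.one_mem_strictPeriods_Gamma1 N) f G

/-- If `f ∈ S_k(Γ₁(N))` has integral Fourier coefficients and `G ∈ M_w(Γ₁(N))` has an integral
`q`-expansion, then `f G` has integral Fourier coefficients (cf.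
`exists_int_eq_cuspCoeff_mulModularForm` for level-one `G`). [folklore] -/
theorem exists_int_eq_cuspCoeff_mulModularForm_gamma1 {G : ModularForm (Gamma1 N) w}
    {P₀ : PowerSeries ℤ} (hG : P₀.map (Int.castRingHom ℂ) = qExpansion 1 (⇑G : ℍ → ℂ))
    {f : CuspForm (Gamma1 N) k} (hf : ∀ n, ∃ z : ℤ, (z : ℂ) = cuspCoeff f n) (n : ℕ) :
    ∃ z : ℤ, (z : ℂ) = cuspCoeff (f.mulModularForm G) n := by
  choose z hz using hf
  refine ⟨PowerSeries.coeff n (PowerSeries.mk z * P₀), ?_⟩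
  change _ = PowerSeries.coeff n (qExpansion 1 ⇑(f.mulModularForm G))
  rw [qExpansion_mulModularForm_gamma1, ← hG,
    show qExpansion 1 ⇑f = (PowerSeries.mk z).map (Int.castRingHom ℂ) from ?_, ← map_mul,
    PowerSeries.coeff_map, eq_intCast]
  ext m
  rw [PowerSeries.coeff_map, PowerSeries.coeff_mk, eq_intCast, hz m]
  rfl

/-- **Diamond operators and multiplication by a form with character `χ₋₄`**: if
`G ∣[w] γ = χ₋₄(d) G` for all `γ = (a b; c d) ∈ Γ₀(N)`, then `⟨d⟩ (f G) = ± (⟨d⟩ f) G` on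
`S_k(Γ₁(N))` — `⟨d⟩` is `F ↦ F ∣ γ_d` for a chosen `γ_d ∈ Γ₀(N)` (Diamond–Shurman §5.2,
`coe_cuspHeckeOperatorₗ_gamma1`), and `(f G) ∣ γ_d = (f ∣ γ_d)(G ∣ γ_d)`; for a non-unit `d` both
diamond operators are the junk value `id`. [folklore] -/
theorem diamondOp_mulModularForm_of_slash_chi4 (G : ModularForm (Gamma1 N) w)
    (hG : ∀ γ : SL(2, ℤ), γ ∈ Gamma0 N → (⇑G : ℍ → ℂ) ∣[w] γ = chi4 (γ 1 1) • (⇑G : ℍ → ℂ))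
    (d : ZMod N) (f : CuspForm (Gamma1 N) k) :
    ∃ ε : ℂ, (ε = 1 ∨ ε = -1) ∧
      diamondOp N (k + w) d (f.mulModularForm G) = ε • (diamondOp N k d f).mulModularForm G := by
  unfold diamondOp
  split_ifs with h
  · refine ⟨chi4 (((h.choose : Gamma0 N) : SL(2, ℤ)) 1 1), ?_, ?_⟩
    · unfold chi4
      split_ifs
      · exact Or.inr rfl
      · exact Or.inl rfl
    apply DFunLike.coe_injective
    change ⇑(cuspHeckeOperatorₗ (Gamma1 N) (k + w) (slToGLPos h.choose) _) = _
    rw [coe_cuspHeckeOperatorₗ_gamma1, CuspForm.coe_mulModularForm, CuspForm.IsGLPos.coe_smul,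
      CuspForm.coe_mulModularForm]
    change _ = _ • (⇑(cuspHeckeOperatorₗ (Gamma1 N) k (slToGLPos h.choose) f) * _)
    rw [coe_cuspHeckeOperatorₗ_gamma1,
      show (Matrix.SpecialLinearGroup.mapGL ℝ ((h.choose : Gamma0 N) : SL(2, ℤ)) :
          GL (Fin 2) ℝ) = (((h.choose : Gamma0 N) : SL(2, ℤ)) : GL (Fin 2) ℝ) from rfl,
      ← ModularForm.SL_slash, ← ModularForm.SL_slash, ModularForm.mul_slash_SL2,
      hG _ (h.choose).2, mul_smul_comm]
  · exact ⟨1, Or.inl rfl, by rw [one_smul]; rfl⟩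

/-- Cancelling a zero-free function. [folklore] -/
theorem eq_of_mul_eq_mul_of_forall_ne_zero {g a b : ℍ → ℂ} (hg : ∀ τ, g τ ≠ 0)
    (h : g * a = g * b) : a = b :=
  funext fun τ ↦ mul_left_cancel₀ (hg τ) (congrFun h τ)

end MulForm

/-! ### 2. Division by the two weight-one `η`-quotients -/

section Division

variable {N : ℕ} [NeZero N] {k : ℤ}

omit [NeZero N] in
/-- Automorphy as a pointwise identity: `F(γτ) = F(τ) j(γ, τ)^k` for a modular form `F` of
weight `k` on `Γ₁(N)` and `γ ∈ Γ₁(N)`. [folklore] -/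
theorem apply_smul_eq_mul_denom_zpow {F : Type*} [FunLike F ℍ ℂ]
    [SlashInvariantFormClass F (Gamma1 N) k] (h : F) {γ : SL(2, ℤ)} (hγ : γ ∈ Gamma1 N) (τ : ℍ) :
    h (γ • τ) = h τ * denom γ τ ^ k := by
  have hh := congrFun (SlashInvariantFormClass.slash_action_eq h
    (Matrix.SpecialLinearGroup.mapGL ℝ γ) ⟨γ, hγ, rfl⟩) τ
  rw [show (Matrix.SpecialLinearGroup.mapGL ℝ γ : GL (Fin 2) ℝ) = (γ : GL (Fin 2) ℝ) from rfl,
    ← ModularForm.SL_slash, ModularForm.SL_slash_apply] at hh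
  have hd : denom γ τ ≠ 0 := denom_ne_zero γ τ
  calc h (γ • τ) = h (γ • τ) * denom γ τ ^ (-k) * denom γ τ ^ k := by
        rw [mul_assoc, ← zpow_add₀ hd, neg_add_cancel, zpow_zero, mul_one]
    _ = h τ * denom γ τ ^ k := by rw [hh]

/-- **Division by `g₁ = η(2τ)¹⁰/(η(τ)η(4τ))⁴` and `g₂ = g₁(2τ)`** (`8 ∣ N`): if
`h₁, h₂ ∈ S_{k+1}(Γ₁(N))` satisfy `h₁ g₂ = h₂ g₁`, then `h₁ = f g₁`, `h₂ = f g₂` for a cusp form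
`f ∈ S_k(Γ₁(N))`.  Indeed `f = h₁/g₁ = h₂/g₂` is holomorphic on `ℍ` since `g₁` has no zero there
(`η ≠ 0`), transforms correctly under `Γ₁(N)`, and decays at every cusp `A∞` because `h₁ ∣ A`,
`h₂ ∣ A → 0` while one of `g₁ ∣ A`, `g₂ ∣ A` stays bounded away from `0`
(`exists_eventually_le_norm_thetaSqForm_slash`: the two `η`-quotients have no common zero at any
cusp). [folklore] -/
theorem exists_of_thetaSqTwo_mul_eq (h8 : 8 ∣ N) (h₁ h₂ : CuspForm (Gamma1 N) (k + 1))
    (heq : (⇑h₁ : ℍ → ℂ) * ⇑(thetaSqTwoForm N h8) = ⇑h₂ * ⇑(thetaSqForm N h8)) :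
    ∃ f : CuspForm (Gamma1 N) k, f.mulModularForm (thetaSqForm N h8) = h₁ ∧
      f.mulModularForm (thetaSqTwoForm N h8) = h₂ := by
  set G₁ := thetaSqForm N h8 with hG₁
  set G₂ := thetaSqTwoForm N h8 with hG₂
  have hne : ∀ τ : ℍ, G₁ τ ≠ 0 ∧ G₂ τ ≠ 0 := thetaSqForm_ne_zero N h8
  -- the quotient `F = h₁/g₁ = h₂/g₂`
  set F : ℍ → ℂ := fun τ ↦ h₁ τ / G₁ τ with hF
  have hF₁ : ∀ τ, F τ = h₁ τ / G₁ τ := fun τ ↦ rfl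
  have hF₂ : ∀ τ, F τ = h₂ τ / G₂ τ := fun τ ↦ by
    have h := congrFun heq τ
    simp only [Pi.mul_apply] at h
    rw [hF₁, div_eq_div_iff (hne τ).1 (hne τ).2]
    exact h
  -- holomorphy
  have hFhol : MDiff F := by
    have hh1 := h₁.holo'
    have hg1 := G₁.holo'
    rw [UpperHalfPlane.mdifferentiable_iff] at hh1 hg1 ⊢
    exact (hh1.div hg1 fun z _ ↦ (hne _).1).congr fun z _ ↦ by
      simp only [Function.comp_apply, hF₁]
      rfl
  -- invariance under `Γ₁(N)`
  have hFslash : ∀ γ : SL(2, ℤ), γ ∈ Gamma1 N → F ∣[k] (γ : GL (Fin 2) ℝ) = F := by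
    intro γ hγ
    funext τ
    rw [← ModularForm.SL_slash, ModularForm.SL_slash_apply, hF₁, hF₁,
      apply_smul_eq_mul_denom_zpow h₁ hγ τ, apply_smul_eq_mul_denom_zpow G₁ hγ τ]
    have hd : denom γ τ ≠ 0 := denom_ne_zero γ τ
    have hdk : denom γ τ ^ k ≠ 0 := zpow_ne_zero k hd
    have hG0 := (hne τ).1
    rw [zpow_add_one₀ hd, zpow_one, zpow_neg]
    field_simp
  -- the quotient identity after an `SL₂(ℤ)`-translation
  have hq : ∀ (G : ModularForm (Gamma1 N) 1) (hh : CuspForm (Gamma1 N) (k + 1)),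
      (∀ τ, G τ ≠ 0) → (∀ τ, F τ = hh τ / G τ) → ∀ (A : SL(2, ℤ)) (τ : ℍ),
        (F ∣[k] (A : GL (Fin 2) ℝ)) τ = ((⇑hh : ℍ → ℂ) ∣[k + 1] (A : GL (Fin 2) ℝ)) τ /
          ((⇑G : ℍ → ℂ) ∣[(1 : ℤ)] (A : GL (Fin 2) ℝ)) τ := by
    intro G hh hG0 hFG A τ
    rw [← ModularForm.SL_slash, ← ModularForm.SL_slash, ← ModularForm.SL_slash,
      ModularForm.SL_slash_apply, ModularForm.SL_slash_apply, ModularForm.SL_slash_apply, hFG]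
    have hd : denom A τ ≠ 0 := denom_ne_zero A τ
    have hdk : denom A τ ^ k ≠ 0 := zpow_ne_zero k hd
    have := hG0 (A • τ)
    rw [zpow_neg, zpow_neg, zpow_neg, zpow_one, zpow_add_one₀ hd]
    field_simp
  -- decay at every cusp
  have hFzero : ∀ A : SL(2, ℤ), IsZeroAtImInfty (F ∣[k] (A : GL (Fin 2) ℝ)) := by
    intro A
    obtain ⟨C, hC, hcases⟩ := exists_eventually_le_norm_thetaSqForm_slash N h8 A
    have key : ∀ (G : ModularForm (Gamma1 N) 1) (hh : CuspForm (Gamma1 N) (k + 1)),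
        (∀ τ, G τ ≠ 0) → (∀ τ, F τ = hh τ / G τ) →
        (∀ᶠ τ in atImInfty, C ≤ ‖((⇑G : ℍ → ℂ) ∣[(1 : ℤ)] (A : GL (Fin 2) ℝ)) τ‖) →
          IsZeroAtImInfty (F ∣[k] (A : GL (Fin 2) ℝ)) := by
      intro G hh hG0 hFG hev
      have hzero : IsZeroAtImInfty ((⇑hh : ℍ → ℂ) ∣[k + 1] (A : GL (Fin 2) ℝ)) := by
        simpa [ModularForm.SL_slash] using CuspFormClass.zero_at_infty_slash hh A
      rw [IsZeroAtImInfty, ZeroAtFilter] at hzero ⊢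
      refine squeeze_zero_norm' ?_ (by simpa using (hzero.norm).mul_const C⁻¹)
      filter_upwards [hev] with τ hτ
      rw [hq G hh hG0 hFG A τ, norm_div]
      calc ‖((⇑hh : ℍ → ℂ) ∣[k + 1] (A : GL (Fin 2) ℝ)) τ‖ /
            ‖((⇑G : ℍ → ℂ) ∣[(1 : ℤ)] (A : GL (Fin 2) ℝ)) τ‖
          ≤ ‖((⇑hh : ℍ → ℂ) ∣[k + 1] (A : GL (Fin 2) ℝ)) τ‖ / C :=
            div_le_div_of_nonneg_left (norm_nonneg _) hC hτ
        _ = ‖((⇑hh : ℍ → ℂ) ∣[k + 1] (A : GL (Fin 2) ℝ)) τ‖ * C⁻¹ := div_eq_mul_inv _ _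
    rcases hcases with hev | hev
    · exact key G₁ h₁ (fun τ ↦ (hne τ).1) hF₁ hev
    · exact key G₂ h₂ (fun τ ↦ (hne τ).2) hF₂ hev
  -- the cusp form
  let f : CuspForm (Gamma1 N) k :=
    { toFun := F
      slash_action_eq' := fun A hA ↦ by
        obtain ⟨γ, hγ, rfl⟩ := hA
        exact hFslash γ hγ
      holo' := hFhol
      zero_at_cusps' := fun {c} hc ↦ by
        rw [Subgroup.IsArithmetic.isCusp_iff_isCusp_SL2Z] at hc
        rw [OnePoint.isZeroAt_iff_forall_SL2Z hc]
        intro A _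
        exact hFzero A }
  have hcoe : (⇑f : ℍ → ℂ) = F := rfl
  refine ⟨f, ?_, ?_⟩
  · apply DFunLike.coe_injective
    rw [CuspForm.coe_mulModularForm, hcoe]
    funext τ
    rw [Pi.mul_apply, hF₁]
    exact div_mul_cancel₀ _ (hne τ).1
  · apply DFunLike.coe_injective
    rw [CuspForm.coe_mulModularForm, hcoe]
    funext τ
    rw [Pi.mul_apply, hF₂]
    exact div_mul_cancel₀ _ (hne τ).2

end Division

/-! ### 3. The descent `k + 1 ↦ k` of Deligne–Serre's (2.7.2) at levels `8 ∣ N` -/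

section Descent

variable {N : ℕ} [NeZero N] {k : ℤ}

/-- **Weight descent for Deligne–Serre 1974, (2.7.2), by a pair of weight-one forms.**  Let
`G₁, G₂ ∈ M₁(Γ₁(N))` have integral `q`-expansions, `G₁ ∈ 1 + qℤ⟦q⟧` a unit, `G₁` zero-free on
`ℍ` with `G₁ ∣[1] γ = χ₋₄(d) G₁` on `Γ₀(N)`, and assume the division property: `h₁ G₂ = h₂ G₁`
in `S_{k+1}(Γ₁(N))` forces `hᵢ = f Gᵢ` with `f ∈ S_k(Γ₁(N))`.  If the integral lattice of weight
`k + 1` spans `S_{k+1}(Γ₁(N))`, then the integral lattice of weight `k` spans `S_k(Γ₁(N))`.  This is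
the proof of `DeligneSerre1974_span_integralLattice1.of_weight_add`
(`DeligneSerreProp27WeightReductionProofs`) with `(E₄, E₆)` replaced by `(G₁, G₂)`:
`f ↦ (f G₁, f G₂)` identifies `S_k` with the pairs `(h₁, h₂)`, `h₁ G₂ = h₂ G₁`, a linear system
with integer coefficients on lattice coordinates, whose solutions are spanned by rational ones
(`exists_algebraMap_coords`); a rational solution `h₁ = f G₁` has `D f ∈ L_k` since
`⟨d⟩(D f) G₁ = ±⟨d⟩(D h₁)` (`diamondOp_mulModularForm_of_slash_chi4`) and `G₁⁻¹ ∈ ℤ⟦q⟧`.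
[cite: DeligneSerreASENS1974, Prop. 2.7 (2.7.2) and Rem. 2.8] -/
theorem DeligneSerre1974_span_integralLattice1.of_weight_succ_of_pair
    (G₁ G₂ : ModularForm (Gamma1 N) 1)
    (hP₁ex : ∃ P₁ : PowerSeries ℤ, PowerSeries.constantCoeff P₁ = 1 ∧
      P₁.map (Int.castRingHom ℂ) = qExpansion 1 (⇑G₁ : ℍ → ℂ))
    (hP₂ex : ∃ P₂ : PowerSeries ℤ, P₂.map (Int.castRingHom ℂ) = qExpansion 1 (⇑G₂ : ℍ → ℂ))
    (hne : ∀ τ : ℍ, G₁ τ ≠ 0)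
    (hg1slash : ∀ γ : SL(2, ℤ), γ ∈ Gamma0 N →
      (⇑G₁ : ℍ → ℂ) ∣[(1 : ℤ)] γ = chi4 (γ 1 1) • (⇑G₁ : ℍ → ℂ))
    (hdiv : ∀ h₁ h₂ : CuspForm (Gamma1 N) (k + 1), (⇑h₁ : ℍ → ℂ) * ⇑G₂ = ⇑h₂ * ⇑G₁ →
      ∃ f : CuspForm (Gamma1 N) k, f.mulModularForm G₁ = h₁ ∧ f.mulModularForm G₂ = h₂)
    (h : DeligneSerre1974_span_integralLattice1 N (k + 1)) :
    DeligneSerre1974_span_integralLattice1 N k := by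
  classical
  intro hk
  obtain ⟨P₁, hP₁1, hP₁'⟩ := hP₁ex
  obtain ⟨P₂, hP₂'⟩ := hP₂ex
  have hΓ := HeckeTGamma1.one_mem_strictPeriods_Gamma1 N
  rw [eq_top_iff]
  rintro f -
  -- Step 1: `f g₁`, `f g₂` are complex combinations of lattice forms of weight `k + 1`
  obtain ⟨n₁, α, g, hg⟩ := Submodule.mem_span_set'.mp
    (show f.mulModularForm G₁ ∈ Submodule.span ℂ (integralLattice1 N (k + 1) : Set _) by
      rw [h (by omega)]; trivial)
  obtain ⟨n₂, β, h', hh⟩ := Submodule.mem_span_set'.mp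
    (show f.mulModularForm G₂ ∈ Submodule.span ℂ (integralLattice1 N (k + 1) : Set _) by
      rw [h (by omega)]; trivial)
  -- the integer tables `A i n = aₙ(gᵢ g₂)`, `B j n = aₙ(h'ⱼ g₁)`
  have hA' : ∀ (i : Fin n₁) (n : ℕ), ∃ z : ℤ,
      (z : ℂ) = cuspCoeff ((g i : CuspForm (Gamma1 N) (k + 1)).mulModularForm G₂) n :=
    fun i ↦ exists_int_eq_cuspCoeff_mulModularForm_gamma1 hP₂'
      (exists_int_eq_cuspCoeff_of_mem_integralLattice1 (g i).2)
  have hB' : ∀ (j : Fin n₂) (n : ℕ), ∃ z : ℤ,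
      (z : ℂ) = cuspCoeff ((h' j : CuspForm (Gamma1 N) (k + 1)).mulModularForm G₁) n :=
    fun j ↦ exists_int_eq_cuspCoeff_mulModularForm_gamma1 hP₁'
      (exists_int_eq_cuspCoeff_of_mem_integralLattice1 (h' j).2)
  choose A hA using hA'
  choose B hB using hB'
  -- Step 2: rational coordinates `q` for the coefficient vector `(α, β)` on `c : Fin t → ℂ`
  obtain ⟨t, c, q, hγ, hrel⟩ :
      ∃ (t : ℕ) (c : Fin t → ℂ) (q : Fin n₁ ⊕ Fin n₂ → Fin t → ℚ),
        (∀ i, Sum.elim α β i = ∑ l, (q i l : ℂ) * c l) ∧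
        ∀ r : Fin n₁ ⊕ Fin n₂ → ℚ, ∑ i, (r i : ℂ) * Sum.elim α β i = 0 →
          ∀ l, ∑ i, r i * q i l = 0 := by
    simpa only [eq_ratCast] using
      Literature.LinearAlgebra.BaseChange.exists_algebraMap_coords ℚ (Sum.elim α β)
  -- Step 3: the integer relations
  -- `∑ᵢ αᵢ aₙ(gᵢ g₂) - ∑ⱼ βⱼ aₙ(h'ⱼ g₁) = aₙ(f g₁ g₂) - aₙ(f g₂ g₁) = 0`
  have hlin : ∀ {w w' : ℤ} (E : ModularForm (Gamma1 N) w') {ι : Type} [Fintype ι] (a : ι → ℂ)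
      (x : ι → CuspForm (Gamma1 N) w) (n : ℕ),
      cuspCoeff ((∑ i, a i • x i).mulModularForm E) n =
        ∑ i, a i * cuspCoeff ((x i).mulModularForm E) n := by
    intro w w' E ι _ a x n
    rw [sum_smul_mulModularForm, ← cuspCoeffₗ_apply hΓ, map_sum]
    simp only [map_smul, cuspCoeffₗ_apply, smul_eq_mul]
  have hrelation : ∀ n : ℕ,
      ∑ x, ((Sum.elim (fun i ↦ (A i n : ℚ)) (fun j ↦ -(B j n : ℚ)) x : ℚ) : ℂ) *
        Sum.elim α β x = 0 := by
    intro n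
    have e1 : cuspCoeff ((f.mulModularForm G₁).mulModularForm G₂) n =
        ∑ i, α i * cuspCoeff ((g i : CuspForm (Gamma1 N) (k + 1)).mulModularForm G₂) n := by
      rw [← hg, hlin]
    have e2 : cuspCoeff ((f.mulModularForm G₂).mulModularForm G₁) n =
        ∑ j, β j * cuspCoeff ((h' j : CuspForm (Gamma1 N) (k + 1)).mulModularForm G₁) n := by
      rw [← hh, hlin]
    have e3 : cuspCoeff ((f.mulModularForm G₁).mulModularForm G₂) n =
        cuspCoeff ((f.mulModularForm G₂).mulModularForm G₁) n := by
      change PowerSeries.coeff n (qExpansion 1 ⇑((f.mulModularForm G₁).mulModularForm G₂)) =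
        PowerSeries.coeff n (qExpansion 1 ⇑((f.mulModularForm G₂).mulModularForm G₁))
      rw [show (⇑((f.mulModularForm G₁).mulModularForm G₂) : ℍ → ℂ) =
          ⇑((f.mulModularForm G₂).mulModularForm G₁) by
        simp only [CuspForm.coe_mulModularForm]; ring]
    rw [Fintype.sum_sum_type]
    simp only [Sum.elim_inl, Sum.elim_inr, Rat.cast_intCast, Rat.cast_neg, hA, hB, neg_mul,
      Finset.sum_neg_distrib]
    rw [add_neg_eq_zero]
    simp only [mul_comm _ (α _), mul_comm _ (β _)]
    rw [← e1, ← e2, e3]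
  -- Step 4: the rational combinations `G l = ∑ᵢ q_{il} gᵢ`, `H l = ∑ⱼ q_{jl} h'ⱼ` satisfy
  -- `(G l) g₂ = (H l) g₁` (compare `q`-expansions)
  set G : Fin t → CuspForm (Gamma1 N) (k + 1) := fun l ↦
    ∑ i, ((q (Sum.inl i) l : ℚ) : ℂ) • (g i : CuspForm (Gamma1 N) (k + 1)) with hGdef
  set H : Fin t → CuspForm (Gamma1 N) (k + 1) := fun l ↦
    ∑ j, ((q (Sum.inr j) l : ℚ) : ℂ) • (h' j : CuspForm (Gamma1 N) (k + 1)) with hHdef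
  have hGH : ∀ l, (⇑(G l) : ℍ → ℂ) * ⇑G₂ = ⇑(H l) * ⇑G₁ := by
    intro l
    have hcoeff : ∀ n, cuspCoeff ((G l).mulModularForm G₂) n =
        cuspCoeff ((H l).mulModularForm G₁) n := by
      intro n
      have hq := hrel _ (hrelation n) l
      rw [Fintype.sum_sum_type] at hq
      simp only [Sum.elim_inl, Sum.elim_inr, neg_mul, Finset.sum_neg_distrib] at hq
      rw [add_neg_eq_zero] at hq
      have hq' := congrArg (fun r : ℚ ↦ (r : ℂ)) hq
      simp only [Rat.cast_sum, Rat.cast_mul, Rat.cast_intCast, hA, hB] at hq'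
      have eG : cuspCoeff ((G l).mulModularForm G₂) n =
          ∑ i, ((q (Sum.inl i) l : ℚ) : ℂ) *
            cuspCoeff ((g i : CuspForm (Gamma1 N) (k + 1)).mulModularForm G₂) n := by
        rw [hGdef, hlin]
      have eH : cuspCoeff ((H l).mulModularForm G₁) n =
          ∑ j, ((q (Sum.inr j) l : ℚ) : ℂ) *
            cuspCoeff ((h' j : CuspForm (Gamma1 N) (k + 1)).mulModularForm G₁) n := by
        rw [hHdef, hlin]
      rw [eG, eH]
      simpa only [mul_comm] using hq'
    have := congrArg (fun Φ : CuspForm (Gamma1 N) (k + 1 + 1) ↦ (⇑Φ : ℍ → ℂ))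
      (eq_of_forall_cuspCoeff_eq hΓ hcoeff)
    change (⇑((G l).mulModularForm G₂) : ℍ → ℂ) = ⇑((H l).mulModularForm G₁) at this
    rwa [CuspForm.coe_mulModularForm, CuspForm.coe_mulModularForm] at this
  -- Step 5: divide: `G l = F l g₁`, `H l = F l g₂` with `F l ∈ S_k(Γ₁(N))`
  choose F hF1 hF2 using fun l ↦ hdiv (G l) (H l) (hGH l)
  -- Step 6: `f = ∑ₗ cₗ Fₗ` (multiply by `g₁` and cancel)
  have hfsum : f = ∑ l, c l • F l := by
    apply DFunLike.coe_injective
    refine eq_of_mul_eq_mul_of_forall_ne_zero (g := ⇑G₁) hne ?_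
    have e1 : (⇑G₁ : ℍ → ℂ) * ⇑f = ⇑(f.mulModularForm G₁) := by
      rw [CuspForm.coe_mulModularForm, mul_comm]
    have e2 : (⇑G₁ : ℍ → ℂ) * ⇑(∑ l, c l • F l) = ⇑((∑ l, c l • F l).mulModularForm G₁) := by
      rw [CuspForm.coe_mulModularForm, mul_comm]
    rw [e1, e2, ← hg, sum_smul_mulModularForm]
    congr 1
    simp only [hF1]
    have hα : ∀ i, α i = ∑ l, (q (Sum.inl i) l : ℂ) * c l := fun i ↦ hγ (Sum.inl i)
    simp only [hGdef, Finset.smul_sum, smul_smul, hα, Finset.sum_smul]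
    rw [Finset.sum_comm]
    exact Finset.sum_congr rfl fun i _ ↦ Finset.sum_congr rfl fun l _ ↦ by rw [mul_comm]
  -- Step 7: each `F l` lies in `ℚ L_k ⊆ span_ℂ L_k`: clear denominators and invert `g₁` in `ℤ⟦q⟧`
  have hFmem : ∀ l,
      F l ∈ Submodule.span ℂ (integralLattice1 N k : Set (CuspForm (Gamma1 N) k)) := by
    intro l
    set D : ℕ := ∏ i, (q (Sum.inl i) l).den with hD
    have hD0 : (D : ℂ) ≠ 0 := by
      rw [Nat.cast_ne_zero, hD]
      exact Finset.prod_ne_zero_iff.mpr fun i _ ↦ (q (Sum.inl i) l).den_ne_zero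
    have hDq : ∀ i, ∃ z : ℤ, (z : ℚ) = D * q (Sum.inl i) l := by
      intro i
      obtain ⟨m, hm⟩ : (q (Sum.inl i) l).den ∣ D := Finset.dvd_prod_of_mem _ (Finset.mem_univ i)
      refine ⟨m * (q (Sum.inl i) l).num, ?_⟩
      rw [hm]
      push_cast
      rw [← Rat.mul_den_eq_num (q (Sum.inl i) l)]
      ring
    choose z hz using hDq
    have hDG : (D : ℂ) • G l ∈ integralLattice1 N (k + 1) := by
      have : (D : ℂ) • G l = ∑ i, (z i : ℤ) • (g i : CuspForm (Gamma1 N) (k + 1)) := by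
        rw [hGdef]
        dsimp only
        rw [Finset.smul_sum]
        refine Finset.sum_congr rfl fun i _ ↦ ?_
        rw [smul_smul, ← Int.cast_smul_eq_zsmul ℂ, ← Rat.cast_intCast (α := ℂ), hz i]
        push_cast
        rfl
      rw [this]
      exact Submodule.sum_mem _ fun i _ ↦ Submodule.smul_mem _ _ (g i).2
    have hDF : (D : ℂ) • F l ∈ integralLattice1 N k := by
      rw [mem_integralLattice1]
      intro d n
      have hmem : diamondOp N (k + 1) (d : ZMod N) ((D : ℂ) • G l) ∈ integralLattice1 N (k + 1) :=
        diamondOp_mem_integralLattice1 hDG d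
      obtain ⟨ε, hε, hεeq⟩ :=
        diamondOp_mulModularForm_of_slash_chi4 G₁ hg1slash (d : ZMod N) ((D : ℂ) • F l)
      have hεε : ε * ε = 1 := by rcases hε with rfl | rfl <;> norm_num
      have hprod : (diamondOp N k (d : ZMod N) ((D : ℂ) • F l)).mulModularForm G₁ =
          ε • diamondOp N (k + 1) (d : ZMod N) ((D : ℂ) • G l) := by
        rw [← hF1, ← smul_mulModularForm, hεeq, smul_smul, hεε, one_smul]
      obtain ⟨R₀, hR₀⟩ := exists_map_eq_of_forall_exists_int_eq
        (Q := qExpansion 1 ⇑(diamondOp N (k + 1) (d : ZMod N) ((D : ℂ) • G l)))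
        (fun m ↦ exists_int_eq_cuspCoeff_of_mem_integralLattice1 hmem m)
      obtain ⟨e, he⟩ : ∃ e : ℤ, (e : ℂ) = ε := by
        rcases hε with rfl | rfl
        · exact ⟨1, by simp⟩
        · exact ⟨-1, by simp⟩
      have hmul : P₁.map (Int.castRingHom ℂ) *
          qExpansion 1 ⇑(diamondOp N k (d : ZMod N) ((D : ℂ) • F l)) =
            (PowerSeries.C e * R₀).map (Int.castRingHom ℂ) := by
        have h1 : qExpansion 1
            ⇑((diamondOp N k (d : ZMod N) ((D : ℂ) • F l)).mulModularForm G₁) =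
            qExpansion 1 ⇑(diamondOp N k (d : ZMod N) ((D : ℂ) • F l)) * qExpansion 1 ⇑G₁ :=
          qExpansion_mulModularForm_gamma1 G₁ _
        rw [hprod, CuspForm.IsGLPos.coe_smul, ModularForm.qExpansion_smul one_pos hΓ ε
          (diamondOp N (k + 1) (d : ZMod N) ((D : ℂ) • G l))] at h1
        rw [map_mul, PowerSeries.map_C, eq_intCast, he, hR₀, hP₁', mul_comm, ← h1,
          PowerSeries.smul_eq_C_mul]
      obtain ⟨Q₀, hQ₀⟩ := exists_map_eq_of_map_mul_eq hP₁1 hmul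
      refine ⟨PowerSeries.coeff n Q₀, ?_⟩
      change _ = PowerSeries.coeff n (qExpansion 1 ⇑(diamondOp N k (d : ZMod N) ((D : ℂ) • F l)))
      rw [← hQ₀, PowerSeries.coeff_map, eq_intCast]
    have : F l = (D : ℂ)⁻¹ • ((D : ℂ) • F l) := by rw [smul_smul, inv_mul_cancel₀ hD0, one_smul]
    rw [this]
    exact Submodule.smul_mem _ _ (Submodule.subset_span hDF)
  rw [hfsum]
  exact Submodule.sum_mem _ fun l _ ↦ Submodule.smul_mem _ _ (hFmem l)

/-- **Weight descent for Deligne–Serre 1974, (2.7.2), by the weight-one `η`-quotients of level `8`**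
(`8 ∣ N`): if the integral lattice of weight `k + 1` spans `S_{k+1}(Γ₁(N))`, then the integral
lattice of weight `k` spans `S_k(Γ₁(N))` — `of_weight_succ_of_pair` for
`(G₁, G₂) = (η(2τ)¹⁰/(η(τ)η(4τ))⁴, G₁(2τ))` (`thetaSqForm`, `thetaSqTwoForm`): integral unit
`q`-expansions (`exists_int_map_eq_qExpansion_etaQuotient`), zero-free, character `χ₋₄`
(`thetaSqForm_slash_of_mem_Gamma0`), and the division property `exists_of_thetaSqTwo_mul_eq` (no
common zero on `ℍ ∪ {cusps}`). [cite: DeligneSerreASENS1974, Prop. 2.7 (2.7.2) and Rem. 2.8] -/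
theorem DeligneSerre1974_span_integralLattice1.of_weight_succ_of_eight_dvd (h8 : 8 ∣ N)
    (h : DeligneSerre1974_span_integralLattice1 N (k + 1)) :
    DeligneSerre1974_span_integralLattice1 N k :=
  DeligneSerre1974_span_integralLattice1.of_weight_succ_of_pair (thetaSqForm N h8)
    (thetaSqTwoForm N h8)
    (exists_int_map_eq_qExpansion_etaQuotient 8 thetaSqExp thetaTypeCond_thetaSqExp.sum_mul_eq)
    (let ⟨P, _, hP⟩ := exists_int_map_eq_qExpansion_etaQuotient 8 thetaSqTwoExp
      thetaTypeCond_thetaSqTwoExp.sum_mul_eq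
    ⟨P, hP⟩)
    (fun τ ↦ (thetaSqForm_ne_zero N h8 τ).1)
    (fun _ hγ ↦ (thetaSqForm_slash_of_mem_Gamma0 h8 hγ).1)
    (exists_of_thetaSqTwo_mul_eq h8) h

end Descent

/-! ### 4. Weight one at level `N` from weight one at level `8N`; assembly -/

section WeightOne

variable {N : ℕ} [NeZero N]

/-- The inclusion `[α₁] : S_k(Γ₁(M)) → S_k(Γ₁(N'))` (`M ∣ N'`) preserves Fourier coefficients
(`cuspCoeff_degeneracyMap1` with `d = 1`). [folklore] -/
theorem cuspCoeff_degeneracyMap1_one {M N' : ℕ} [NeZero M] [NeZero N'] {k : ℤ} (hM : M ∣ N')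
    (g : CuspForm (Gamma1 M) k) (n : ℕ) :
    cuspCoeff (degeneracyMap1 M N' 1 k g) n = cuspCoeff g n := by
  rw [cuspCoeff_degeneracyMap1 (by simpa using hM)]
  simp

/-- `aₙ(0) = 0`. [folklore] -/
theorem cuspCoeff_zero_gamma1 {M : ℕ} {k : ℤ} (n : ℕ) :
    cuspCoeff (0 : CuspForm (Gamma1 M) k) n = 0 := by
  change PowerSeries.coeff n (qExpansion 1 ⇑(0 : CuspForm (Gamma1 M) k)) = 0
  rw [show (⇑(0 : CuspForm (Gamma1 M) k) : ℍ → ℂ) = 0 from rfl, UpperHalfPlane.qExpansion_zero,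
    map_zero]

/-- A non-zero cusp form on `Γ₁(M)` has a non-zero Fourier coefficient. [folklore] -/
theorem exists_cuspCoeff_ne_zero_gamma1 {M : ℕ} {k : ℤ} {g : CuspForm (Gamma1 M) k} (hg : g ≠ 0) :
    ∃ n, cuspCoeff g n ≠ 0 := by
  by_contra h
  push Not at h
  exact hg (eq_of_forall_cuspCoeff_eq_gamma1 fun n ↦ by rw [h n, cuspCoeff_zero_gamma1])

/-- `[α₁] g ≠ 0` for `g ≠ 0`. [folklore] -/
theorem degeneracyMap1_one_ne_zero {M N' : ℕ} [NeZero M] [NeZero N'] {k : ℤ} (hM : M ∣ N')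
    {g : CuspForm (Gamma1 M) k} (hg : g ≠ 0) : degeneracyMap1 M N' 1 k g ≠ 0 := by
  obtain ⟨n, hn⟩ := exists_cuspCoeff_ne_zero_gamma1 hg
  intro h0
  apply hn
  rw [← cuspCoeff_degeneracyMap1_one hM g n, h0, cuspCoeff_zero_gamma1]

/-- **`g(τ)` and `g(2τ)` are linearly independent** for a non-zero weight-one cusp form `g`:
`[α₁] g - c [α₂] g ≠ 0` (`M · 2 ∣ N'`).  Compare the coefficient at the least `n` with
`aₙ(g) ≠ 0` (`n ≥ 1`): `aₙ([α₁]g - c[α₂]g) = aₙ(g) - c·𝟙_{2∣n} a_{n/2}(g) = aₙ(g)`. [folklore] -/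
theorem degeneracyMap1_one_sub_smul_two_ne_zero {M N' : ℕ} [NeZero M] [NeZero N'] (hM : M ∣ N')
    (hM2 : M * 2 ∣ N') {g : CuspForm (Gamma1 M) 1} (hg : g ≠ 0) (c : ℂ) :
    degeneracyMap1 M N' 1 1 g - c • degeneracyMap1 M N' 2 1 g ≠ 0 := by
  classical
  have hex := exists_cuspCoeff_ne_zero_gamma1 hg
  set n₀ := Nat.find hex with hn₀
  have hn₀ne : cuspCoeff g n₀ ≠ 0 := Nat.find_spec hex
  have hmin : ∀ m < n₀, cuspCoeff g m = 0 := fun m hm ↦ by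
    have := Nat.find_min hex hm
    push Not at this
    exact this
  have hn₀pos : 0 < n₀ := by
    rw [Nat.pos_iff_ne_zero]
    intro h0
    apply hn₀ne
    rw [h0]
    exact CuspFormClass.qExpansion_coeff_zero g one_pos
      (HeckeTGamma1.one_mem_strictPeriods_Gamma1 M)
  intro h
  have hcoef : cuspCoeff (degeneracyMap1 M N' 1 1 g - c • degeneracyMap1 M N' 2 1 g) n₀ =
      cuspCoeff (0 : CuspForm (Gamma1 N') 1) n₀ := congrArg (fun F ↦ cuspCoeff F n₀) h
  rw [cuspCoeff_sub_gamma1, cuspCoeff_smul_gamma1, cuspCoeff_degeneracyMap1_one hM,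
    cuspCoeff_degeneracyMap1 hM2, cuspCoeff_zero_gamma1, show (1 : ℤ) - 1 = 0 by norm_num,
    zpow_zero, one_mul] at hcoef
  apply hn₀ne
  by_cases h2 : 2 ∣ n₀
  · rw [if_pos h2, hmin (n₀ / 2) (Nat.div_lt_self hn₀pos one_lt_two), mul_zero, sub_zero] at hcoef
    exact hcoef
  · rw [if_neg h2, mul_zero, sub_zero] at hcoef
    exact hcoef

/-- Two finitely generated subrings of `ℂ` lie in a common one. [folklore] -/
theorem exists_fg_subalgebra_ge_pair (K₁ K₂ : Subalgebra ℤ ℂ)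
    (h₁ : (Subalgebra.toSubmodule K₁).FG) (h₂ : (Subalgebra.toSubmodule K₂).FG) :
    ∃ K : Subalgebra ℤ ℂ, (Subalgebra.toSubmodule K).FG ∧ K₁ ≤ K ∧ K₂ ≤ K := by
  obtain ⟨s₁, hs₁⟩ := h₁
  obtain ⟨s₂, hs₂⟩ := h₂
  refine ⟨Algebra.adjoin ℤ ((s₁ : Set ℂ) ∪ s₂), ?_, ?_, ?_⟩
  · refine fg_adjoin_of_finite ((s₁.finite_toSet).union s₂.finite_toSet) fun x hx ↦ ?_
    rcases hx with hx | hx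
    · refine IsIntegral.of_mem_of_fg K₁ ⟨s₁, hs₁⟩ x ?_
      rw [← Subalgebra.mem_toSubmodule, ← hs₁]
      exact Submodule.subset_span hx
    · refine IsIntegral.of_mem_of_fg K₂ ⟨s₂, hs₂⟩ x ?_
      rw [← Subalgebra.mem_toSubmodule, ← hs₂]
      exact Submodule.subset_span hx
  · intro x hx
    have : x ∈ Subalgebra.toSubmodule K₁ := hx
    rw [← hs₁] at this
    exact Algebra.span_le_adjoin ℤ _ (Submodule.span_mono Set.subset_union_left this)
  · intro x hx
    have : x ∈ Subalgebra.toSubmodule K₂ := hx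
    rw [← hs₂] at this
    exact Algebra.span_le_adjoin ℤ _ (Submodule.span_mono Set.subset_union_right this)

omit [NeZero N] in
/-- An odd prime divides `8N` iff it divides `N`. [folklore] -/
theorem odd_prime_dvd_eight_mul_iff {p : ℕ} (hp : p.Prime) (hp2 : p ≠ 2) : p ∣ N ↔ p ∣ 8 * N := by
  refine ⟨fun h ↦ h.mul_left 8, fun h ↦ ?_⟩
  rcases (Nat.Prime.dvd_mul hp).mp h with h8 | hN
  · exact absurd ((Nat.prime_dvd_prime_iff_eq hp Nat.prime_two).mp
      (Nat.Prime.dvd_of_dvd_pow hp (show p ∣ 2 ^ 3 by simpa using h8))) hp2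
  · exact hN

/-- **`a₂` in weight one through `U₂` at level `8N`** (`2 ∤ N`): for a non-zero weight-one form
`f` of type `(1, ε)` on `Γ₁(N)` with `T₂ f = a₂ f`, granted (2.7.2) in weight `1` at level `8N`,
`a₂` lies in a subring of `ℂ` finitely generated as a `ℤ`-module.  On `⟨ι f, ι₂ f⟩ ⊆ S₁(Γ₁(8N))`
(`ι = [α₁]`, `ι₂ = [α₂]`): `U₂ ι f = a₂ ι f - ε(2) ι₂ f`, `U₂ ι₂ f = ι f` (Diamond–Shurman
Prop. 5.6.2), so for the roots `α, β` of `X² - a₂X + ε(2)` the non-zero vectors `ι f - β ι₂ f`,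
`ι f - α ι₂ f` are `U₂`-eigenvectors with eigenvalues `α`, `β`; these lie in finitely generated
rings (`exists_fg_subalgebra_of_span_integralLattice1` at level `8N`), hence are integral, and
`a₂ = α + β ∈ ℤ[α, β]`. [cite: DiamondShurman2005, Prop. 5.6.2] -/
theorem weightOne_heckeEigenvalue_two_mem
    (hL : DeligneSerre1974_span_integralLattice1 (8 * N) 1) (h2N : ¬ 2 ∣ N)
    (ε : DirichletCharacter ℂ N) (f : CuspForm (Gamma1 N) 1) (hfε : f ∈ nebentypusSubspace N 1 ε)
    (hf0 : f ≠ 0) (heig : ∃ a : ℂ, heckeT (Gamma1 N) 1 2 f = a • f) :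
    ∃ K₂ : Subalgebra ℤ ℂ, (Subalgebra.toSubmodule K₂).FG ∧ heckeEigenvalue f 2 ∈ K₂ := by
  haveI : NeZero (8 * N) := ⟨mul_ne_zero (by norm_num) (NeZero.ne N)⟩
  set lam := heckeEigenvalue f 2 with hlam
  have hT : heckeT (Gamma1 N) 1 2 f = lam • f := heckeT_eq_heckeEigenvalue_smul f 2 heig
  -- `⟨2⟩ f = ε(2) f`
  obtain ⟨u, hu⟩ := ZMod.isUnit_prime_of_not_dvd Nat.prime_two h2N
  have hdiam : diamondOp N 1 ((2 : ℕ) : ZMod N) f = ε (u : ZMod N) • f := by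
    rw [← hu]
    exact mem_nebentypusSubspace_iff_diamondOp.mp hfε u
  set e₂ : ℂ := ε (u : ZMod N) with he₂
  -- the two old forms at level `8N`
  have hN1 : N * 1 ∣ 8 * N := ⟨8, by ring⟩
  have hN2 : N * 2 ∣ 8 * N := ⟨4, by ring⟩
  have h8N : 2 ∣ 8 * N := ⟨4 * N, by ring⟩
  set v₁ := degeneracyMap1 N (8 * N) 1 1 f with hv₁
  set v₂ := degeneracyMap1 N (8 * N) 2 1 f with hv₂
  set U := heckeT (Gamma1 (8 * N)) 1 2 with hU
  have hU1 : U v₁ = lam • v₁ - e₂ • v₂ := by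
    haveI : NeZero (1 * 2) := ⟨by norm_num⟩
    have h := heckeT_degeneracyMap1_of_dvd_of_not_dvd (M := N) (N := 8 * N) (d := 1) 1 (p := 2)
      hN1 (by simpa using hN2) Nat.prime_two h8N h2N (by norm_num) f
    rw [hT, map_smul, hdiam, map_smul] at h
    have e : degeneracyMap1 N (8 * N) (1 * 2) 1 = degeneracyMap1 N (8 * N) 2 1 := rfl
    rw [e] at h
    exact h
  have hU2 : U v₂ = v₁ := by
    haveI : NeZero (2 * 1) := ⟨by norm_num⟩
    have h := heckeT_degeneracyMap1_mul (M := N) (N := 8 * N) 1 (p := 2) (e := 1)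
      (by simpa using hN2) hN1 Nat.prime_two h8N f
    rw [show (1 : ℤ) - 1 = 0 by norm_num, zpow_zero, one_smul] at h
    have e : degeneracyMap1 N (8 * N) (2 * 1) 1 = degeneracyMap1 N (8 * N) 2 1 := rfl
    rw [e] at h
    exact h
  -- the roots `α, β` of `X² - λX + e₂`
  obtain ⟨s, hs⟩ := IsAlgClosed.exists_pow_nat_eq (lam ^ 2 - 4 * e₂) two_pos
  set α : ℂ := (lam + s) / 2 with hα
  set β : ℂ := (lam - s) / 2 with hβ
  have hsum : α + β = lam := by rw [hα, hβ]; ring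
  have hprod : α * β = e₂ := by
    rw [hα, hβ]
    linear_combination (-(1 : ℂ) / 4) * hs
  -- the eigenvectors
  have heigvec : ∀ {x y : ℂ}, x + y = lam → x * y = e₂ → U (v₁ - y • v₂) = x • (v₁ - y • v₂) := by
    intro x y hxy hxy'
    rw [map_sub, map_smul, hU1, hU2, ← hxy, ← hxy']
    module
  have hwα : v₁ - β • v₂ ≠ 0 := degeneracyMap1_one_sub_smul_two_ne_zero (dvd_mul_left N 8) hN2 hf0 β
  have hwβ : v₁ - α • v₂ ≠ 0 := degeneracyMap1_one_sub_smul_two_ne_zero (dvd_mul_left N 8) hN2 hf0 α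
  have hUα : U (v₁ - β • v₂) = α • (v₁ - β • v₂) := heigvec hsum hprod
  have hUβ : U (v₁ - α • v₂) = β • (v₁ - α • v₂) :=
    heigvec (by rw [add_comm]; exact hsum) (by rw [mul_comm]; exact hprod)
  have hstab : ∀ x ∈ integralLattice1 (8 * N) 1, U x ∈ integralLattice1 (8 * N) 1 :=
    fun x hx ↦ heckeT_mem_integralLattice1 le_rfl hx 2 Nat.prime_two
  obtain ⟨Kα, hKαfg, hKα⟩ := exists_fg_subalgebra_of_span_integralLattice1 hL le_rfl hwα
  obtain ⟨Kβ, hKβfg, hKβ⟩ := exists_fg_subalgebra_of_span_integralLattice1 hL le_rfl hwβ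
  have hαint : IsIntegral ℤ α := IsIntegral.of_mem_of_fg Kα hKαfg α (hKα U α hstab hUα)
  have hβint : IsIntegral ℤ β := IsIntegral.of_mem_of_fg Kβ hKβfg β (hKβ U β hstab hUβ)
  refine ⟨Algebra.adjoin ℤ {α, β}, fg_adjoin_of_finite (Set.toFinite _) ?_, ?_⟩
  · rintro x (rfl | rfl)
    · exact hαint
    · exact hβint
  · rw [← hsum]
    exact add_mem (Algebra.subset_adjoin (by simp)) (Algebra.subset_adjoin (by simp))

end WeightOne

/-! ### 5. `prop27_eigenvalues` from weight two at the levels `8N` -/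

section Assembly

/-- **Deligne–Serre 1974, Prop. 2.7 (2.7.3) in weight one, from (2.7.2) in weight one at the levels
divisible by `8`.**  For `0 ≠ f ∈ S₁(N, ε)` an eigenform of the `T_p`, `p ∤ N`: the `a_p` for odd
`p` are eigenvalues of `T_p` on `S₁(Γ₁(8N))` at the old form `ι f`
(`heckeT_degeneracyMap1_of_not_dvd`), hence lie in the finitely generated ring attached to `ι f` by
the lattice argument at level `8N` (`exists_fg_subalgebra_of_span_integralLattice1`); `a₂` (if
`2 ∤ N`) is handled by `weightOne_heckeEigenvalue_two_mem`; elements of such rings are integral,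
and `ℚ(a_p : p ∤ N)` is finite over `ℚ`. [cite: DeligneSerreASENS1974, Prop. 2.7 (2.7.3)] -/
theorem prop27_weightOne_of_span_integralLattice1_one_of_eight_dvd
    (hL : ∀ (M : ℕ) [NeZero M], 8 ∣ M → DeligneSerre1974_span_integralLattice1 M 1) :
    ∀ ⦃N : ℕ⦄ [NeZero N] (ε : DirichletCharacter ℂ N) (f : CuspForm (Gamma1 N) 1),
      f ∈ nebentypusSubspace N 1 ε → f ≠ 0 →
      (∀ p : ℕ, (hp : p.Prime) → ¬ p ∣ N →
        ∃ a : ℂ, (haveI : NeZero p := ⟨hp.ne_zero⟩; heckeT (Gamma1 N) 1 p f) = a • f) →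
      ∃ K : IntermediateField ℚ ℂ, FiniteDimensional ℚ K ∧
        ∀ p : ℕ, p.Prime → ¬ p ∣ N →
          heckeEigenvalue f p ∈ K ∧ IsIntegral ℤ (heckeEigenvalue f p) := by
  intro N _ ε f hfε hf0 heig
  haveI : NeZero (8 * N) := ⟨mul_ne_zero (by norm_num) (NeZero.ne N)⟩
  have hL' : DeligneSerre1974_span_integralLattice1 (8 * N) 1 := hL (8 * N) (dvd_mul_right 8 N)
  have hN1 : N * 1 ∣ 8 * N := ⟨8, by ring⟩
  set v₁ := degeneracyMap1 N (8 * N) 1 1 f with hv₁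
  have hv₁0 : v₁ ≠ 0 := degeneracyMap1_one_ne_zero (dvd_mul_left N 8) hf0
  obtain ⟨K', hK'fg, hK'⟩ := exists_fg_subalgebra_of_span_integralLattice1 hL' le_rfl hv₁0
  -- odd primes
  have hodd : ∀ p : ℕ, p.Prime → ¬ p ∣ N → p ≠ 2 → heckeEigenvalue f p ∈ K' := by
    intro p hp hpN hp2
    haveI : NeZero p := ⟨hp.ne_zero⟩
    have hT := heckeT_eq_heckeEigenvalue_smul f p (heig p hp hpN)
    have hcomm := heckeT_degeneracyMap1_of_not_dvd (M := N) (N := 8 * N) (d := 1) 1 hN1 hp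
      (fun h ↦ hp.ne_one (Nat.dvd_one.mp h)) (odd_prime_dvd_eight_mul_iff hp hp2) f
    refine hK' _ _ (fun x hx ↦ heckeT_mem_integralLattice1 le_rfl hx p hp) ?_
    rw [hv₁, hcomm, hT, map_smul]
  -- a common finitely generated ring containing all `a_p`, `p ∤ N`
  obtain ⟨K'', hK''fg, hK'le, h2mem⟩ : ∃ K'' : Subalgebra ℤ ℂ, (Subalgebra.toSubmodule K'').FG ∧
      K' ≤ K'' ∧ (¬ 2 ∣ N → heckeEigenvalue f 2 ∈ K'') := by
    by_cases h2N : 2 ∣ N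
    · exact ⟨K', hK'fg, le_rfl, fun h ↦ absurd h2N h⟩
    · obtain ⟨K₂, hK₂fg, hmem⟩ :=
        weightOne_heckeEigenvalue_two_mem hL' h2N ε f hfε hf0 (heig 2 Nat.prime_two h2N)
      obtain ⟨K'', hfg, h1, h2⟩ := exists_fg_subalgebra_ge_pair K' K₂ hK'fg hK₂fg
      exact ⟨K'', hfg, h1, fun _ ↦ h2 hmem⟩
  set S : Set ℂ := {a | ∃ p : ℕ, p.Prime ∧ ¬ p ∣ N ∧ a = heckeEigenvalue f p} with hS
  have hSK'' : S ⊆ K'' := by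
    rintro _ ⟨p, hp, hpN, rfl⟩
    by_cases hp2 : p = 2
    · subst hp2
      exact h2mem hpN
    · exact hK'le (hodd p hp hpN hp2)
  refine ⟨IntermediateField.adjoin ℚ S,
    finiteDimensional_of_le_adjoin_of_subset_fg_subalgebra K'' hK''fg hSK'' _ le_rfl,
    fun p hp hpN ↦ ⟨IntermediateField.subset_adjoin ℚ S ⟨p, hp, hpN, rfl⟩, ?_⟩⟩
  exact IsIntegral.of_mem_of_fg K'' hK''fg _ (hSK'' ⟨p, hp, hpN, rfl⟩)

/-- **`prop27_eigenvalues` from Deligne–Serre's (2.7.2) in weight one at the levels divisible by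
`8`** (weights `≠ 1` need nothing: `prop27_eigenvalues_iff_weight_one`).
[cite: DeligneSerreASENS1974, Prop. 2.7 (2.7.2)–(2.7.3)] -/
theorem prop27_eigenvalues_of_span_integralLattice1_one_of_eight_dvd
    (hL : ∀ (M : ℕ) [NeZero M], 8 ∣ M → DeligneSerre1974_span_integralLattice1 M 1) :
    DeligneSerre1974.prop27_eigenvalues :=
  DeligneSerre1974.prop27_eigenvalues_iff_weight_one.mpr
    (prop27_weightOne_of_span_integralLattice1_one_of_eight_dvd hL)

/-- **(2.7.2) descends from a weight `K₀` to every weight `k ≤ K₀` at levels `8 ∣ N`** (iterate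
`of_weight_succ_of_eight_dvd`). [cite: DeligneSerreASENS1974, Prop. 2.7 (2.7.2) and Rem. 2.8] -/
theorem DeligneSerre1974_span_integralLattice1.of_le_of_eight_dvd {N : ℕ} [NeZero N] (h8 : 8 ∣ N)
    {K₀ : ℤ} (H : DeligneSerre1974_span_integralLattice1 N K₀) {k : ℤ} (hk : k ≤ K₀) :
    DeligneSerre1974_span_integralLattice1 N k := by
  obtain ⟨m, rfl⟩ : ∃ m : ℕ, k = K₀ - m := ⟨(K₀ - k).toNat, by omega⟩
  clear hk
  induction m with
  | zero => simpa using H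
  | succ m ih =>
    refine DeligneSerre1974_span_integralLattice1.of_weight_succ_of_eight_dvd h8 ?_
    rwa [show K₀ - ((m + 1 : ℕ) : ℤ) + 1 = K₀ - (m : ℕ) by push_cast; ring]

/-- **`prop27_eigenvalues` from Deligne–Serre's (2.7.2) in WEIGHT TWO at the levels divisible by
`8`.** [cite: DeligneSerreASENS1974, Prop. 2.7 (2.7.2)–(2.7.3) and Rem. 2.8] -/
theorem prop27_eigenvalues_of_span_integralLattice1_two_of_eight_dvd
    (hL : ∀ (M : ℕ) [NeZero M], 8 ∣ M → DeligneSerre1974_span_integralLattice1 M 2) :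
    DeligneSerre1974.prop27_eigenvalues :=
  prop27_eigenvalues_of_span_integralLattice1_one_of_eight_dvd fun M _ h8 ↦
    DeligneSerre1974_span_integralLattice1.of_le_of_eight_dvd h8 (hL M h8) one_le_two

/-- **`prop27_eigenvalues` from a full Hecke-stable real lattice in `S₂(Γ₁(M))^∨` for every level
`8 ∣ M`** (`HeckeStableRealLattice`, Shimura 1971 (3.5.20) in weight `2`;
`DeligneSerre1974_span_integralLattice1_of_heckeStableRealLattice`): the weight-one case of
Deligne–Serre's Prop. 2.7 (2.7.3) reduced to weight-two Eichler–Shimura for `Γ₁(M)`.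
[cite: Shimura1971, (3.5.20) and Thm. 3.52] -/
theorem prop27_eigenvalues_of_forall_heckeStableRealLattice_two
    (H : ∀ (M : ℕ) [NeZero M], 8 ∣ M → Nonempty (HeckeStableRealLattice M 2)) :
    DeligneSerre1974.prop27_eigenvalues :=
  prop27_eigenvalues_of_span_integralLattice1_two_of_eight_dvd fun M _ h8 ↦
    (H M h8).elim fun Λ ↦ DeligneSerre1974_span_integralLattice1_of_heckeStableRealLattice le_rfl Λ

/-- **`prop27_eigenvalues` from the rank statement of weight-two Eichler–Shimura for `Γ₁(M)`,
`8 ∣ M`**: if for every such `M` the period lattice `periodLatticeK1 0` of `S₂(Γ₁(M))`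
(`EichlerShimuraPeriodsGamma1`; proved finitely generated, Hecke-stable and separating) is the
`ℤ`-span of an `ℝ`-basis of the dual space — the exact `Γ₁(M)` analogue of the discharged
`periodHomology_eq_span_basis` (`Γ₀(N)`) — then Deligne–Serre's Prop. 2.7 (2.7.3)
(`prop27_eigenvalues`) holds in every weight. [cite: Shimura1971, Thm. 8.4 and Prop. 8.6] -/
theorem prop27_eigenvalues_of_forall_periodLatticeK1_zero_eq_span
    (H : ∀ (M : ℕ) [NeZero M], 8 ∣ M →
      ∃ (m : ℕ) (b : Module.Basis (Fin m) ℝ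
        (Module.Dual ℂ (CuspForm (Gamma1 M) (((0 : ℕ) : ℤ) + 2)))),
        (periodLatticeK1 (N := M) 0 :
            Set (Module.Dual ℂ (CuspForm (Gamma1 M) (((0 : ℕ) : ℤ) + 2)))) =
          Submodule.span ℤ (Set.range b)) :
    DeligneSerre1974.prop27_eigenvalues :=
  prop27_eigenvalues_of_forall_heckeStableRealLattice_two fun M _ h8 ↦ by
    obtain ⟨m, b, hb⟩ := H M h8
    have := nonempty_heckeStableRealLattice_of_periodLatticeK1_eq_span b hb
    simpa using this

end Assembly

/-! ### 6. One weight `K₀ ≥ 7` suffices: junction with the real spanning theorem -/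

section OneWeight

/-- **`prop27_eigenvalues` from Deligne–Serre's (2.7.2) in ONE weight `K₀ ≥ 1` at the levels
divisible by `8`** (`of_le_of_eight_dvd` down to weight one).
[cite: DeligneSerreASENS1974, Prop. 2.7 (2.7.2)–(2.7.3) and Rem. 2.8] -/
theorem prop27_eigenvalues_of_span_integralLattice1_of_eight_dvd {K₀ : ℤ} (hK₀ : 1 ≤ K₀)
    (hL : ∀ (M : ℕ) [NeZero M], 8 ∣ M → DeligneSerre1974_span_integralLattice1 M K₀) :
    DeligneSerre1974.prop27_eigenvalues :=
  prop27_eigenvalues_of_span_integralLattice1_one_of_eight_dvd fun M _ h8 ↦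
    DeligneSerre1974_span_integralLattice1.of_le_of_eight_dvd h8 (hL M h8) hK₀

/-- **`prop27_eigenvalues` from a full Hecke-stable real lattice in ONE weight `K₀ ≥ 2` at the
levels divisible by `8`** (Shimura 1971, (3.5.20) for `Γ₁(M)` in weight `K₀`).
[cite: Shimura1971, (3.5.20) and Thm. 3.52] -/
theorem prop27_eigenvalues_of_forall_heckeStableRealLattice_of_two_le {K₀ : ℤ} (hK₀ : 2 ≤ K₀)
    (H : ∀ (M : ℕ) [NeZero M], 8 ∣ M → Nonempty (HeckeStableRealLattice M K₀)) :
    DeligneSerre1974.prop27_eigenvalues :=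
  prop27_eigenvalues_of_span_integralLattice1_of_eight_dvd (by omega : (1 : ℤ) ≤ K₀) fun M _ h8 ↦
    (H M h8).elim fun Λ ↦ DeligneSerre1974_span_integralLattice1_of_heckeStableRealLattice hK₀ Λ

/-- **`prop27_eigenvalues` from the RANK half of Eichler–Shimura in one weight `n + 2 ≥ 7` at the
levels divisible by `8`.**  The spanning half — the period lattice `periodLatticeK1 n` of
`S_{n+2}(Γ₁(M))` spans the dual space over `ℝ` — is the tree's theorem
`periodLatticeK1_span_real_eq_top` (`EichlerShimuraPeriodsGamma1RealSpanProofs`, `n ≥ 5`, via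
twisted `L`-values), packaged with the rank hypothesis as `heckeStableRealLatticeOfGenerators`.  So
Deligne–Serre's Prop. 2.7 (2.7.3) in every weight, weight one included, follows from: for every
`M` with `8 ∣ M` and one fixed `n ≥ 5`, `periodLatticeK1 n` is the `ℤ`-span of
`2 dim_ℂ S_{n+2}(Γ₁(M))` functionals (Manin's presentation of the weight-`(n+2)` modular symbols of
`Γ₁(M)` with the dimension formula for `S_{n+2}(Γ₁(M))`; Shimura 1971, Thm. 8.4 / Prop. 8.6).
[cite: Shimura1971, Thm. 8.4 and Prop. 8.6] -/
theorem prop27_eigenvalues_of_forall_periodLatticeK1_eq_span_of_five_le (n : ℕ) (hn : 5 ≤ n)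
    (H : ∀ (M : ℕ) [NeZero M], 8 ∣ M →
      ∃ g : Fin (2 * Module.finrank ℂ (CuspForm (Gamma1 M) (n + 2))) →
        Module.Dual ℂ (CuspForm (Gamma1 M) (n + 2)),
        (periodLatticeK1 (N := M) n : Set (Module.Dual ℂ (CuspForm (Gamma1 M) (n + 2)))) =
          Submodule.span ℤ (Set.range g)) :
    DeligneSerre1974.prop27_eigenvalues :=
  prop27_eigenvalues_of_forall_heckeStableRealLattice_of_two_le (K₀ := n + 2) (by omega)
    fun M _ h8 ↦ by
      obtain ⟨g, hg⟩ := H M h8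
      exact ⟨heckeStableRealLatticeOfGenerators hn g hg⟩

end OneWeight

end Literature.NumberTheory.EllipticCurves.ModularForms
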